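import Mathlib
import HarnessLib

/-!
# ζ(5) search — Wendel's inequalities and polynomial-order bounds for real Gamma ratios (cell `pub-zeta5`, ct-1 g26)

HONEST FRAMING: systematic search; no irrationality claim unless kernel-certified.  Elementary real-analysis
inequalities; nothing here is an irrationality result; no named fact is discharged.

Second half of brick B5e of `HOME/ct-1/g26/VWP-BLUEPRINT.md`: the coefficients of the series side of Dougall's Carlson
function, `c_μ = (h₀+2μ)·Γ(h₀+μ)Γ(h₁+μ)Γ(h₂+μ)/(Γ(μ+1)Γ(h₀−h₁+1+μ)Γ(h₀−h₂+1+μ))`, are `≍ μ^{2(h₁+h₂)−h₀−2}`, hence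
absolutely summable iff `2(h₁+h₂) < 1+h₀`.  This file proves the UPPER bound and the summability from Wendel's
inequalities (log-convexity of `Γ`, Mathlib's `Real.Gamma_mul_add_mul_le_rpow_Gamma_mul_rpow_Gamma`):

* `Gamma_add_le_rpow_mul_Gamma` — `Γ(x+θ) ≤ x^θ Γ(x)` (`x > 0`, `0 ≤ θ ≤ 1`); `mul_rpow_mul_Gamma_le_Gamma_add` — the lower
  companion `x (x+θ)^{θ−1} Γ(x) ≤ Γ(x+θ)`;
* `Gamma_add_le_rpow_mul_Gamma_of_nonneg` — `Γ(x+a) ≤ (x+a)^a Γ(x)` (`x ≥ 1`, `a ≥ 0`); `Gamma_add_ge` —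
  `x^b Γ(x) ≤ 2 Γ(x+b)` (`x ≥ 1`, `b ≥ 0`); `Gamma_ratio_le` — `Γ(x+a)/Γ(x+b) ≤ 2^{1+a} x^{a−b}` for `x ≥ max 1 a`;
* `dougallCoeff_le` — `c_μ ≤ K μ^{2(h₁+h₂)−h₀−2}` for `μ ≥ μ₀` (real `h₀, h₁, h₂ > 0`, `h₁, h₂ < h₀+1`), and
  `summable_dougallCoeff` — `Σ_μ c_μ < ∞` when moreover `2(h₁+h₂) < 1+h₀`, with the bridge `dougallCoeff_complex` to the
  complex-valued coefficients of `DougallCarlsonSides` / `DougallSeriesSide`.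
Theorems only (no new definitions).
-/

noncomputable section

namespace Summit.KontsevichZagierPeriods.Zeta5Search.DougallCoefficientBounds

open Finset Filter Real

/-! ### 1. Wendel's inequalities -/

/-- **Wendel (upper)**: `Γ(x+θ) ≤ x^θ·Γ(x)` for `x > 0`, `0 ≤ θ ≤ 1` (log-convexity of `Γ` between `x` and `x+1`). -/
theorem Gamma_add_le_rpow_mul_Gamma {x θ : ℝ} (hx : 0 < x) (h0 : 0 ≤ θ) (h1 : θ ≤ 1) :
    Real.Gamma (x + θ) ≤ x ^ θ * Real.Gamma x := by
  have hΓ : 0 < Real.Gamma x := Real.Gamma_pos_of_pos hx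
  rcases h0.eq_or_lt with h0' | h0'
  · rw [← h0']; simp
  rcases h1.lt_or_eq with h1' | h1'
  · have key := Real.Gamma_mul_add_mul_le_rpow_Gamma_mul_rpow_Gamma hx (by linarith : 0 < x + 1)
      (by linarith : 0 < 1 - θ) h0' (by ring)
    rw [show (1 - θ) * x + θ * (x + 1) = x + θ by ring, Real.Gamma_add_one hx.ne',
      Real.mul_rpow hx.le hΓ.le] at key
    calc Real.Gamma (x + θ) ≤ Real.Gamma x ^ (1 - θ) * (x ^ θ * Real.Gamma x ^ θ) := key
      _ = x ^ θ * (Real.Gamma x ^ (1 - θ) * Real.Gamma x ^ θ) := by ring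
      _ = x ^ θ * Real.Gamma x := by rw [← Real.rpow_add hΓ, show (1 - θ) + θ = 1 by ring, Real.rpow_one]
  · rw [h1', Real.Gamma_add_one hx.ne', Real.rpow_one]

/-- **Wendel (lower)**: `x·(x+θ)^{θ−1}·Γ(x) ≤ Γ(x+θ)` for `x > 0`, `0 ≤ θ ≤ 1`. -/
theorem mul_rpow_mul_Gamma_le_Gamma_add {x θ : ℝ} (hx : 0 < x) (h0 : 0 ≤ θ) (h1 : θ ≤ 1) :
    x * (x + θ) ^ (θ - 1) * Real.Gamma x ≤ Real.Gamma (x + θ) := by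
  have hxθ : 0 < x + θ := by linarith
  have h := Gamma_add_le_rpow_mul_Gamma hxθ (by linarith : 0 ≤ 1 - θ) (by linarith : 1 - θ ≤ 1)
  rw [show x + θ + (1 - θ) = x + 1 by ring, Real.Gamma_add_one hx.ne'] at h
  have hpow : 0 < (x + θ) ^ (θ - 1) := Real.rpow_pos_of_pos hxθ _
  have e : (x + θ) ^ (θ - 1) * (x + θ) ^ (1 - θ) = 1 := by
    rw [← Real.rpow_add hxθ, show (θ - 1) + (1 - θ) = 0 by ring, Real.rpow_zero]
  calc x * (x + θ) ^ (θ - 1) * Real.Gamma x = (x + θ) ^ (θ - 1) * (x * Real.Gamma x) := by ring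
    _ ≤ (x + θ) ^ (θ - 1) * ((x + θ) ^ (1 - θ) * Real.Gamma (x + θ)) := mul_le_mul_of_nonneg_left h hpow.le
    _ = Real.Gamma (x + θ) := by rw [← mul_assoc, e, one_mul]

/-! ### 2. Real shifts by an arbitrary `a ≥ 0` -/

/-- `Γ(y + n) = Γ(y)·∏_{i<n}(y+i)` for `y > 0`. -/
theorem Gamma_add_nat_eq (y : ℝ) (hy : 0 < y) (n : ℕ) :
    Real.Gamma (y + n) = Real.Gamma y * ∏ i ∈ range n, (y + i) := by
  induction n with
  | zero => simp
  | succ n ih =>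
    rw [Nat.cast_succ, ← add_assoc, Real.Gamma_add_one (by positivity), ih, prod_range_succ]
    ring

/-- **Upper shift bound**: `Γ(x+a) ≤ (x+a)^a·Γ(x)` for `x ≥ 1`, `a ≥ 0`. -/
theorem Gamma_add_le_rpow_mul_Gamma_of_nonneg {x a : ℝ} (hx : 1 ≤ x) (ha : 0 ≤ a) :
    Real.Gamma (x + a) ≤ (x + a) ^ a * Real.Gamma x := by
  set n : ℕ := ⌊a⌋₊ with hn
  set θ : ℝ := a - n with hθ
  have hθ0 : 0 ≤ θ := by rw [hθ]; linarith [Nat.floor_le ha]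
  have hθ1 : θ < 1 := by rw [hθ]; linarith [Nat.lt_floor_add_one a]
  have hx0 : 0 < x := by linarith
  have hΓ : 0 < Real.Gamma x := Real.Gamma_pos_of_pos hx0
  have hxθ : 0 < x + θ := by linarith
  have e1 : x + a = (x + θ) + n := by rw [hθ]; ring
  have hprod : ∏ i ∈ range n, (x + θ + i) ≤ (x + a) ^ (n : ℝ) := by
    rw [Real.rpow_natCast]
    calc ∏ i ∈ range n, (x + θ + i) ≤ ∏ _i ∈ range n, (x + a) := by
          refine prod_le_prod (fun i _ => by positivity) fun i hi => ?_
          have : (i : ℝ) + 1 ≤ n := by exact_mod_cast mem_range.1 hi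
          linarith
      _ = (x + a) ^ n := by simp
  have hW : Real.Gamma (x + θ) ≤ (x + a) ^ θ * Real.Gamma x :=
    (Gamma_add_le_rpow_mul_Gamma hx0 hθ0 hθ1.le).trans
      (mul_le_mul_of_nonneg_right (Real.rpow_le_rpow hx0.le (by linarith) hθ0) hΓ.le)
  have e2 : (x + a) ^ a = (x + a) ^ θ * (x + a) ^ (n : ℝ) := by
    rw [← Real.rpow_add (by linarith)]; congr 1; rw [hθ]; ring
  rw [show Real.Gamma (x + a) = Real.Gamma ((x + θ) + n) by rw [e1], Gamma_add_nat_eq _ hxθ n, e2]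
  calc Real.Gamma (x + θ) * ∏ i ∈ range n, (x + θ + i)
      ≤ ((x + a) ^ θ * Real.Gamma x) * (x + a) ^ (n : ℝ) :=
        mul_le_mul hW hprod (prod_nonneg fun i _ => by positivity) (by positivity)
    _ = (x + a) ^ θ * (x + a) ^ (n : ℝ) * Real.Gamma x := by ring

/-- **Lower shift bound**: `x^b·Γ(x) ≤ 2·Γ(x+b)` for `x ≥ 1`, `b ≥ 0`. -/
theorem Gamma_add_ge {x b : ℝ} (hx : 1 ≤ x) (hb : 0 ≤ b) : x ^ b * Real.Gamma x ≤ 2 * Real.Gamma (x + b) := by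
  set m : ℕ := ⌊b⌋₊ with hm
  set φ : ℝ := b - m with hφ
  have hφ0 : 0 ≤ φ := by rw [hφ]; linarith [Nat.floor_le hb]
  have hφ1 : φ < 1 := by rw [hφ]; linarith [Nat.lt_floor_add_one b]
  have hx0 : 0 < x := by linarith
  have hΓ : 0 < Real.Gamma x := Real.Gamma_pos_of_pos hx0
  have hxφ : 0 < x + φ := by linarith
  have e1 : x + b = (x + φ) + m := by rw [hφ]; ring
  -- the integer part: `∏ (x+φ+i) ≥ x^m`
  have hprod : x ^ (m : ℝ) ≤ ∏ i ∈ range m, (x + φ + i) := by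
    rw [Real.rpow_natCast]
    calc x ^ m = ∏ _i ∈ range m, x := by simp
      _ ≤ ∏ i ∈ range m, (x + φ + i) :=
          prod_le_prod (fun i _ => hx0.le) fun i _ => by linarith [(i.cast_nonneg : (0 : ℝ) ≤ i)]
  -- the fractional part: `x^φ Γ(x) ≤ 2 Γ(x+φ)` from Wendel's lower bound and `(x+φ)^{φ−1} ≥ (2x)^{φ−1}`
  have hfrac : x ^ φ * Real.Gamma x ≤ 2 * Real.Gamma (x + φ) := by
    have hW := mul_rpow_mul_Gamma_le_Gamma_add hx0 hφ0 hφ1.le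
    have h2x : (x + φ) ^ (φ - 1) ≥ (2 * x) ^ (φ - 1) :=
      Real.rpow_le_rpow_of_nonpos hxφ (by linarith) (by linarith)
    have e2 : (2 * x) ^ (φ - 1) = 2 ^ (φ - 1) * (x ^ φ * x⁻¹) := by
      rw [Real.mul_rpow (by norm_num) hx0.le, Real.rpow_sub hx0, Real.rpow_one, div_eq_mul_inv]
    have h2φ : (1 : ℝ) / 2 ≤ 2 ^ (φ - 1) := by
      rw [show (1 : ℝ) / 2 = 2 ^ (-1 : ℝ) by norm_num]
      exact Real.rpow_le_rpow_of_exponent_le (by norm_num) (by linarith)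
    have key : x * (2 * x) ^ (φ - 1) * Real.Gamma x ≤ Real.Gamma (x + φ) :=
      le_trans (by gcongr) hW
    rw [e2] at key
    have e3 : x * (2 ^ (φ - 1) * (x ^ φ * x⁻¹)) * Real.Gamma x = 2 ^ (φ - 1) * (x ^ φ * Real.Gamma x) := by
      field_simp
    rw [e3] at key
    have hpos : 0 ≤ x ^ φ * Real.Gamma x := by positivity
    nlinarith
  have e2 : x ^ b = x ^ φ * x ^ (m : ℝ) := by rw [← Real.rpow_add hx0]; congr 1; rw [hφ]; ring
  rw [show Real.Gamma (x + b) = Real.Gamma ((x + φ) + m) by rw [e1], Gamma_add_nat_eq _ hxφ m, e2]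
  calc x ^ φ * x ^ (m : ℝ) * Real.Gamma x = (x ^ φ * Real.Gamma x) * x ^ (m : ℝ) := by ring
    _ ≤ (2 * Real.Gamma (x + φ)) * ∏ i ∈ range m, (x + φ + i) :=
        mul_le_mul hfrac hprod (by positivity) (by positivity)
    _ = 2 * (Real.Gamma (x + φ) * ∏ i ∈ range m, (x + φ + i)) := by ring

/-- **Two-sided polynomial order of a Gamma ratio (upper bound)**: for `a, b ≥ 0` and `x ≥ max 1 a`,
`Γ(x+a)/Γ(x+b) ≤ 2^{1+a}·x^{a−b}`. -/
theorem Gamma_ratio_le {x a b : ℝ} (hx : 1 ≤ x) (hxa : a ≤ x) (ha : 0 ≤ a) (hb : 0 ≤ b) :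
    Real.Gamma (x + a) / Real.Gamma (x + b) ≤ 2 ^ (1 + a) * x ^ (a - b) := by
  have hx0 : 0 < x := by linarith
  have hΓ : 0 < Real.Gamma x := Real.Gamma_pos_of_pos hx0
  have hΓb : 0 < Real.Gamma (x + b) := Real.Gamma_pos_of_pos (by linarith)
  have h1 := Gamma_add_le_rpow_mul_Gamma_of_nonneg hx ha
  have h2 := Gamma_add_ge hx hb
  have h3 : (x + a) ^ a ≤ (2 * x) ^ a := Real.rpow_le_rpow (by linarith) (by linarith) ha
  rw [div_le_iff₀ hΓb]
  have e : (2 : ℝ) ^ (1 + a) * x ^ (a - b) * Real.Gamma (x + b) =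
      (2 * x) ^ a * (x ^ b)⁻¹ * (2 * Real.Gamma (x + b)) := by
    rw [Real.rpow_add (by norm_num), Real.rpow_one, Real.mul_rpow (by norm_num) hx0.le, Real.rpow_sub hx0]
    field_simp
  rw [e]
  have hxb : 0 < x ^ b := Real.rpow_pos_of_pos hx0 _
  calc Real.Gamma (x + a) ≤ (x + a) ^ a * Real.Gamma x := h1
    _ = (x + a) ^ a * (x ^ b)⁻¹ * (x ^ b * Real.Gamma x) := by field_simp
    _ ≤ (2 * x) ^ a * (x ^ b)⁻¹ * (2 * Real.Gamma (x + b)) := by gcongr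

/-! ### 3. The Dougall coefficients: polynomial order and summability -/

/-- **Order of the Dougall coefficients**: for real `h₀, h₁, h₂ > 0` with `h₁, h₂ < h₀+1` there is `K` with
`(h₀+2μ)·Γ(h₀+μ)Γ(h₁+μ)Γ(h₂+μ)/(Γ(μ+1)Γ(h₀−h₁+1+μ)Γ(h₀−h₂+1+μ)) ≤ K·μ^{2(h₁+h₂)−h₀−2}` for all naturals
`μ ≥ max(1, h₀, h₁, h₂)`. -/
theorem dougallCoeff_le (h₀ h₁ h₂ : ℝ) (hh₀ : 0 < h₀) (hh₁ : 0 < h₁) (hh₂ : 0 < h₂) (h1' : h₁ < h₀ + 1)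
    (h2' : h₂ < h₀ + 1) :
    ∃ K : ℝ, ∀ μ : ℕ, max 1 (max h₀ (max h₁ h₂)) ≤ (μ : ℝ) →
      (h₀ + 2 * μ) * (Real.Gamma (h₀ + μ) * Real.Gamma (h₁ + μ) * Real.Gamma (h₂ + μ)) /
          (Real.Gamma ((μ : ℝ) + 1) * Real.Gamma (h₀ - h₁ + 1 + μ) * Real.Gamma (h₀ - h₂ + 1 + μ)) ≤
        K * (μ : ℝ) ^ (2 * (h₁ + h₂) - h₀ - 2) := by
  refine ⟨3 * 2 ^ (1 + h₀) * 2 ^ (1 + h₁) * 2 ^ (1 + h₂), fun μ hμ => ?_⟩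
  set x : ℝ := (μ : ℝ) with hx
  have hx1 : 1 ≤ x := le_trans (le_max_left _ _) hμ
  have hx0 : 0 < x := by linarith
  have hxh₀ : h₀ ≤ x := le_trans ((le_max_left _ _).trans (le_max_right _ _)) hμ
  have hxh₁ : h₁ ≤ x := le_trans (((le_max_left _ _).trans (le_max_right _ _)).trans (le_max_right _ _)) hμ
  have hxh₂ : h₂ ≤ x := le_trans (((le_max_right _ _).trans (le_max_right _ _)).trans (le_max_right _ _)) hμ
  -- the three ratios
  have r0 := Gamma_ratio_le (a := h₀) (b := 1) hx1 hxh₀ hh₀.le zero_le_one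
  have r1 := Gamma_ratio_le (a := h₁) (b := h₀ - h₁ + 1) hx1 hxh₁ hh₁.le (by linarith)
  have r2 := Gamma_ratio_le (a := h₂) (b := h₀ - h₂ + 1) hx1 hxh₂ hh₂.le (by linarith)
  have hG1 : 0 < Real.Gamma (x + 1) := Real.Gamma_pos_of_pos (by linarith)
  have hG2 : 0 < Real.Gamma (x + (h₀ - h₁ + 1)) := Real.Gamma_pos_of_pos (by linarith)
  have hG3 : 0 < Real.Gamma (x + (h₀ - h₂ + 1)) := Real.Gamma_pos_of_pos (by linarith)
  have hP0 : 0 ≤ Real.Gamma (x + h₀) / Real.Gamma (x + 1) := by positivity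
  have hP1 : 0 ≤ Real.Gamma (x + h₁) / Real.Gamma (x + (h₀ - h₁ + 1)) := by positivity
  have hP2 : 0 ≤ Real.Gamma (x + h₂) / Real.Gamma (x + (h₀ - h₂ + 1)) := by positivity
  have e : (h₀ + 2 * x) * (Real.Gamma (h₀ + x) * Real.Gamma (h₁ + x) * Real.Gamma (h₂ + x)) /
        (Real.Gamma (x + 1) * Real.Gamma (h₀ - h₁ + 1 + x) * Real.Gamma (h₀ - h₂ + 1 + x)) =
      (h₀ + 2 * x) * (Real.Gamma (x + h₀) / Real.Gamma (x + 1)) *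
        (Real.Gamma (x + h₁) / Real.Gamma (x + (h₀ - h₁ + 1))) * (Real.Gamma (x + h₂) / Real.Gamma (x + (h₀ - h₂ + 1))) := by
    rw [add_comm h₀ x, add_comm h₁ x, add_comm h₂ x, add_comm (h₀ - h₁ + 1) x, add_comm (h₀ - h₂ + 1) x]
    field_simp
  rw [e]
  have hlin : h₀ + 2 * x ≤ 3 * x ^ (1 : ℝ) := by rw [Real.rpow_one]; linarith
  have hE : (3 * x ^ (1 : ℝ)) * (2 ^ (1 + h₀) * x ^ (h₀ - 1)) * (2 ^ (1 + h₁) * x ^ (h₁ - (h₀ - h₁ + 1))) *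
      (2 ^ (1 + h₂) * x ^ (h₂ - (h₀ - h₂ + 1))) =
      (3 * 2 ^ (1 + h₀) * 2 ^ (1 + h₁) * 2 ^ (1 + h₂)) * x ^ (2 * (h₁ + h₂) - h₀ - 2) := by
    have : x ^ (1 : ℝ) * x ^ (h₀ - 1) * x ^ (h₁ - (h₀ - h₁ + 1)) * x ^ (h₂ - (h₀ - h₂ + 1)) =
        x ^ (2 * (h₁ + h₂) - h₀ - 2) := by
      rw [← Real.rpow_add hx0, ← Real.rpow_add hx0, ← Real.rpow_add hx0]; congr 1; ring
    rw [← this]; ring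
  rw [← hE]
  have h3x : 0 ≤ 3 * x ^ (1 : ℝ) := by positivity
  exact mul_le_mul (mul_le_mul (mul_le_mul hlin r0 hP0 h3x) r1 hP1 (by positivity)) r2 hP2 (by positivity)

/-- **Summability of the Dougall coefficients** for real `h₀, h₁, h₂ > 0` with `2(h₁+h₂) < 1+h₀` (then `h₁, h₂ < h₀+1`
automatically): `Σ_μ (h₀+2μ)Γ(h₀+μ)Γ(h₁+μ)Γ(h₂+μ)/(Γ(μ+1)Γ(h₀−h₁+1+μ)Γ(h₀−h₂+1+μ)) < ∞`. -/
theorem summable_dougallCoeff (h₀ h₁ h₂ : ℝ) (hh₀ : 0 < h₀) (hh₁ : 0 < h₁) (hh₂ : 0 < h₂)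
    (hsum : 2 * (h₁ + h₂) < 1 + h₀) :
    Summable fun μ : ℕ => (h₀ + 2 * μ) * (Real.Gamma (h₀ + μ) * Real.Gamma (h₁ + μ) * Real.Gamma (h₂ + μ)) /
      (Real.Gamma ((μ : ℝ) + 1) * Real.Gamma (h₀ - h₁ + 1 + μ) * Real.Gamma (h₀ - h₂ + 1 + μ)) := by
  obtain ⟨K, hK⟩ := dougallCoeff_le h₀ h₁ h₂ hh₀ hh₁ hh₂ (by linarith) (by linarith)
  have hp : 2 * (h₁ + h₂) - h₀ - 2 < -1 := by linarith
  have hg : Summable fun μ : ℕ => K * (μ : ℝ) ^ (2 * (h₁ + h₂) - h₀ - 2) :=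
    ((Real.summable_nat_rpow.2 hp).mul_left K)
  refine Summable.of_norm_bounded_eventually_nat hg ?_
  rw [Filter.eventually_atTop]
  refine ⟨⌈max 1 (max h₀ (max h₁ h₂))⌉₊, fun μ hμ => ?_⟩
  have hμ' : max 1 (max h₀ (max h₁ h₂)) ≤ (μ : ℝ) := le_trans (Nat.le_ceil _) (by exact_mod_cast hμ)
  have hnn : 0 ≤ (h₀ + 2 * μ) * (Real.Gamma (h₀ + μ) * Real.Gamma (h₁ + μ) * Real.Gamma (h₂ + μ)) /
      (Real.Gamma ((μ : ℝ) + 1) * Real.Gamma (h₀ - h₁ + 1 + μ) * Real.Gamma (h₀ - h₂ + 1 + μ)) := by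
    have := Real.Gamma_pos_of_pos (show 0 < h₀ + μ by positivity)
    have := Real.Gamma_pos_of_pos (show 0 < h₁ + μ by positivity)
    have := Real.Gamma_pos_of_pos (show 0 < h₂ + μ by positivity)
    have := Real.Gamma_pos_of_pos (show 0 < (μ : ℝ) + 1 by positivity)
    have := Real.Gamma_pos_of_pos (show 0 < h₀ - h₁ + 1 + μ by linarith [(μ.cast_nonneg : (0:ℝ) ≤ μ)])
    have := Real.Gamma_pos_of_pos (show 0 < h₀ - h₂ + 1 + μ by linarith [(μ.cast_nonneg : (0:ℝ) ≤ μ)])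
    positivity
  rw [Real.norm_of_nonneg hnn]
  exact hK μ hμ'

/-- **Bridge to the complex coefficients** of `DougallCarlsonSides` / `DougallSeriesSide` at real parameters. -/
theorem dougallCoeff_complex (h₀ h₁ h₂ : ℝ) (μ : ℕ) :
    ((h₀ : ℂ) + 2 * μ) * (Complex.Gamma ((h₀ : ℂ) + μ) * Complex.Gamma ((h₁ : ℂ) + μ) * Complex.Gamma ((h₂ : ℂ) + μ)) /
        (Complex.Gamma ((μ : ℂ) + 1) * Complex.Gamma ((h₀ : ℂ) - h₁ + 1 + μ) * Complex.Gamma ((h₀ : ℂ) - h₂ + 1 + μ)) =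
      (((h₀ + 2 * μ) * (Real.Gamma (h₀ + μ) * Real.Gamma (h₁ + μ) * Real.Gamma (h₂ + μ)) /
        (Real.Gamma ((μ : ℝ) + 1) * Real.Gamma (h₀ - h₁ + 1 + μ) * Real.Gamma (h₀ - h₂ + 1 + μ)) : ℝ) : ℂ) := by
  push_cast
  simp only [← Complex.Gamma_ofReal]
  push_cast
  ring

/-- **Absolute summability of the complex Dougall coefficients** (input `hc` of `DougallSeriesSide.differentiableOn_series`
and `norm_series_le`) for real `h₀, h₁, h₂ > 0` with `2(h₁+h₂) < 1+h₀`. -/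
theorem summable_norm_dougallCoeff_complex (h₀ h₁ h₂ : ℝ) (hh₀ : 0 < h₀) (hh₁ : 0 < h₁) (hh₂ : 0 < h₂)
    (hsum : 2 * (h₁ + h₂) < 1 + h₀) :
    Summable fun μ : ℕ => ‖((h₀ : ℂ) + 2 * μ) *
      (Complex.Gamma ((h₀ : ℂ) + μ) * Complex.Gamma ((h₁ : ℂ) + μ) * Complex.Gamma ((h₂ : ℂ) + μ)) /
        (Complex.Gamma ((μ : ℂ) + 1) * Complex.Gamma ((h₀ : ℂ) - h₁ + 1 + μ) * Complex.Gamma ((h₀ : ℂ) - h₂ + 1 + μ))‖ := by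
  have h := (summable_dougallCoeff h₀ h₁ h₂ hh₀ hh₁ hh₂ hsum).abs
  refine h.congr fun μ => ?_
  rw [dougallCoeff_complex, Complex.norm_real, Real.norm_eq_abs]

end Summit.KontsevichZagierPeriods.Zeta5Search.DougallCoefficientBounds

end
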